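import Summits.KontsevichZagierPeriods.KontsevichZagierPeriods.Theorems.LinRedNormalFormArrangementNormalFormSeparateEngine

/-!
# Cancelling a fat letter: the patch (stub `stub_separateThreeZero`, part `FatPatch`)

(Line `janus-bands`, crux `ArrangementNormalForm`, stub `stub_separateThreeZero` — fibre-free
separation over a bounded rational polytope in `ℝ³`, `JJ 3 0 → closure (GG 2 1 0)`; part
`FatPatch` of the CANCELLATION lemma `JJ 3 0 ≡ thin JJ 3 0`.)

A letter plane `y = λ(x')` (`λ(x') = κ₀ x'₀ + κ₁ x'₁ + c`, a graph over the base) whose contact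
with a convex set `K ⊆ ℝ³` (the closed cell) is FAT — not contained in a line — contains a whole
PATCH of `K`: the graph of `λ` over a ball of the base plane (`SepThree.fat_patch`, registered as
`separateThree_fat_patch`). Proof: three non-collinear contact points (negating thinness), the
open triangle they span lies in the contact (convexity), and it contains the graph over a ball
around the projected centroid (explicit barycentric coordinates).
-/

noncomputable section

open Set

namespace Summit.KontsevichZagierPeriods.ArrangementNormalForm.JanusBands

namespace SepThree

/-- A point of the graph `y = λ(x')` is the graph point over its base. -/
theorem fat_graph_ext (κ : Fin 2 → ℝ) (c : ℝ) {z : Fin (2 + 1) → ℝ}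
    (hz : z (Fin.last 2) = κ 0 * z (Fin.castSucc 0) + κ 1 * z (Fin.castSucc 1) + c) :
    z = Fin.snoc (fun i : Fin 2 => z (Fin.castSucc i))
      (κ 0 * z (Fin.castSucc 0) + κ 1 * z (Fin.castSucc 1) + c) := by
  funext l
  refine Fin.lastCases ?_ (fun i => ?_) l
  · rw [Fin.snoc_last]; exact hz
  · rw [Fin.snoc_castSucc]

/-- `2 × 2` determinant. -/
theorem fat_det_eq_zero_imp {u w : Fin 2 → ℝ} (hu : u ≠ 0) (h : u 0 * w 1 - u 1 * w 0 = 0) :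
    ∃ t : ℝ, w = t • u := by
  by_cases h0 : u 0 = 0
  · have h1 : u 1 ≠ 0 := fun h1 => hu (by ext i; fin_cases i <;> simp [h0, h1])
    refine ⟨w 1 / u 1, ?_⟩
    have hw0 : w 0 = 0 := by
      rw [h0, zero_mul, zero_sub, neg_eq_zero, mul_eq_zero] at h
      exact h.resolve_left h1
    ext i; fin_cases i
    · simp [hw0, h0]
    · simp [div_mul_cancel₀ _ h1]
  · refine ⟨w 0 / u 0, ?_⟩
    ext i; fin_cases i
    · simp [div_mul_cancel₀ _ h0]
    · simp only [Fin.mk_one, Fin.isValue, Pi.smul_apply, smul_eq_mul]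
      field_simp
      linarith

/-- **The patch of a fat contact**: see the module docstring. -/
theorem fat_patch {K : Set (Fin (2 + 1) → ℝ)} (hK : Convex ℝ K) (κ : Fin 2 → ℝ) (c : ℝ)
    (hfat : ¬ ∃ P u : Fin (2 + 1) → ℝ, ∀ z ∈ K,
      z (Fin.last 2) = κ 0 * z (Fin.castSucc 0) + κ 1 * z (Fin.castSucc 1) + c →
      ∃ t : ℝ, z = P + t • u) :
    ∃ x₀ : Fin 2 → ℝ, ∃ ρ > (0 : ℝ), ∀ x : Fin 2 → ℝ, dist x x₀ < ρ →
      (Fin.snoc x (κ 0 * x 0 + κ 1 * x 1 + c) : Fin (2 + 1) → ℝ) ∈ K := by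
  classical
  -- the contact set and three non-collinear points of it
  set F : Set (Fin (2 + 1) → ℝ) := {z ∈ K |
    z (Fin.last 2) = κ 0 * z (Fin.castSucc 0) + κ 1 * z (Fin.castSucc 1) + c} with hF
  have hthin : ∀ P u : Fin (2 + 1) → ℝ, ∃ z ∈ F, ∀ t : ℝ, z ≠ P + t • u := by
    intro P u
    by_contra hall
    push Not at hall
    exact hfat ⟨P, u, fun z hz h => hall z ⟨hz, h⟩⟩
  obtain ⟨A, hA, -⟩ := hthin 0 0
  obtain ⟨B, hB, hBA⟩ := hthin A 0
  have hBA' : B ≠ A := fun h => hBA 0 (by rw [h, zero_smul, add_zero])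
  obtain ⟨C, hC, hCA⟩ := hthin A (B - A)
  -- notation: bases and the affine function
  set lam : (Fin 2 → ℝ) → ℝ := fun x => κ 0 * x 0 + κ 1 * x 1 + c with hlam
  set a : Fin 2 → ℝ := fun i => A (Fin.castSucc i) with ha
  set u : Fin 2 → ℝ := fun i => B (Fin.castSucc i) - A (Fin.castSucc i) with hu
  set w : Fin 2 → ℝ := fun i => C (Fin.castSucc i) - A (Fin.castSucc i) with hw
  have hAg := fat_graph_ext κ c hA.2
  have hBg := fat_graph_ext κ c hB.2
  have hCg := fat_graph_ext κ c hC.2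
  -- a point of the graph is determined by its base: collinear bases give collinear points
  have hline : ∀ (t : ℝ) (Z : Fin (2 + 1) → ℝ), Z ∈ F →
      (fun i : Fin 2 => Z (Fin.castSucc i) - A (Fin.castSucc i)) = t • u → Z = A + t • (B - A) := by
    intro t Z hZ h
    have hZg := fat_graph_ext κ c hZ.2
    have hb : ∀ i : Fin 2, Z (Fin.castSucc i) = A (Fin.castSucc i) + t * (B (Fin.castSucc i) -
        A (Fin.castSucc i)) := fun i => by
      have := congr_fun h i
      simp only [hu, Pi.smul_apply, smul_eq_mul] at this
      linarith
    rw [hZg, hAg, hBg]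
    funext l
    refine Fin.lastCases ?_ (fun i => ?_) l
    · simp only [Fin.snoc_last, Pi.add_apply, Pi.smul_apply, Pi.sub_apply, smul_eq_mul, hb]
      ring
    · simp only [Fin.snoc_castSucc, Pi.add_apply, Pi.smul_apply, Pi.sub_apply, smul_eq_mul, hb]
  have hu0 : u ≠ 0 := fun h0 => hBA' (by
    have := hline 0 B hB (by rw [zero_smul]; exact h0)
    simpa using this)
  set d : ℝ := u 0 * w 1 - u 1 * w 0 with hd
  have hd0 : d ≠ 0 := fun h0 => by
    obtain ⟨t, ht⟩ := fat_det_eq_zero_imp hu0 h0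
    exact hCA t (hline t C hC ht)
  -- barycentric coordinates over the base
  set sfun : (Fin 2 → ℝ) → ℝ := fun x => ((x 0 - a 0) * w 1 - (x 1 - a 1) * w 0) / d with hsfun
  set tfun : (Fin 2 → ℝ) → ℝ := fun x => (u 0 * (x 1 - a 1) - u 1 * (x 0 - a 0)) / d with htfun
  have hcomb : ∀ x : Fin 2 → ℝ, ∀ i : Fin 2, a i + sfun x * u i + tfun x * w i = x i := by
    intro x i
    fin_cases i
    · simp only [hsfun, htfun, Fin.zero_eta, Fin.isValue]
      field_simp
      ring
    · simp only [hsfun, htfun, Fin.mk_one, Fin.isValue]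
      field_simp
      ring
  -- the centroid base and the radius
  set x₀ : Fin 2 → ℝ := fun i => a i + u i / 3 + w i / 3 with hx₀
  have hs₀ : sfun x₀ = 1 / 3 := by
    simp only [hsfun, hx₀]; field_simp; ring
  have ht₀ : tfun x₀ = 1 / 3 := by
    simp only [htfun, hx₀]; field_simp; ring
  set Λ : ℝ := (|u 0| + |u 1| + |w 0| + |w 1| + 1) / |d| with hΛ
  have hΛ0 : 0 < Λ := by rw [hΛ]; positivity
  have hslip : ∀ x, |sfun x - 1 / 3| ≤ Λ * dist x x₀ := fun x => by
    have e1 : sfun x - 1 / 3 = ((x 0 - x₀ 0) * w 1 - (x 1 - x₀ 1) * w 0) / d := by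
      rw [← hs₀]; simp only [hsfun]; field_simp; ring
    rw [e1, abs_div, div_le_iff₀ (abs_pos.2 hd0)]
    have h0 : |x 0 - x₀ 0| ≤ dist x x₀ := by rw [← Real.dist_eq]; exact dist_le_pi_dist x x₀ 0
    have h1 : |x 1 - x₀ 1| ≤ dist x x₀ := by rw [← Real.dist_eq]; exact dist_le_pi_dist x x₀ 1
    calc |(x 0 - x₀ 0) * w 1 - (x 1 - x₀ 1) * w 0|
        ≤ |(x 0 - x₀ 0) * w 1| + |(x 1 - x₀ 1) * w 0| := abs_sub _ _
      _ = |x 0 - x₀ 0| * |w 1| + |x 1 - x₀ 1| * |w 0| := by rw [abs_mul, abs_mul]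
      _ ≤ dist x x₀ * |w 1| + dist x x₀ * |w 0| := by gcongr
      _ ≤ (|u 0| + |u 1| + |w 0| + |w 1| + 1) * dist x x₀ := by
          nlinarith [abs_nonneg (u 0), abs_nonneg (u 1), abs_nonneg (w 0), abs_nonneg (w 1),
            dist_nonneg (x := x) (y := x₀)]
      _ = Λ * dist x x₀ * |d| := by rw [hΛ]; field_simp
  have htlip : ∀ x, |tfun x - 1 / 3| ≤ Λ * dist x x₀ := fun x => by
    have e1 : tfun x - 1 / 3 = (u 0 * (x 1 - x₀ 1) - u 1 * (x 0 - x₀ 0)) / d := by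
      rw [← ht₀]; simp only [htfun]; field_simp; ring
    rw [e1, abs_div, div_le_iff₀ (abs_pos.2 hd0)]
    have h0 : |x 0 - x₀ 0| ≤ dist x x₀ := by rw [← Real.dist_eq]; exact dist_le_pi_dist x x₀ 0
    have h1 : |x 1 - x₀ 1| ≤ dist x x₀ := by rw [← Real.dist_eq]; exact dist_le_pi_dist x x₀ 1
    calc |u 0 * (x 1 - x₀ 1) - u 1 * (x 0 - x₀ 0)|
        ≤ |u 0 * (x 1 - x₀ 1)| + |u 1 * (x 0 - x₀ 0)| := abs_sub _ _
      _ = |u 0| * |x 1 - x₀ 1| + |u 1| * |x 0 - x₀ 0| := by rw [abs_mul, abs_mul]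
      _ ≤ |u 0| * dist x x₀ + |u 1| * dist x x₀ := by gcongr
      _ ≤ (|u 0| + |u 1| + |w 0| + |w 1| + 1) * dist x x₀ := by
          nlinarith [abs_nonneg (u 0), abs_nonneg (u 1), abs_nonneg (w 0), abs_nonneg (w 1),
            dist_nonneg (x := x) (y := x₀)]
      _ = Λ * dist x x₀ * |d| := by rw [hΛ]; field_simp
  refine ⟨x₀, 1 / (6 * Λ), by positivity, fun x hx => ?_⟩
  -- the weights are positive
  have hΛd : Λ * dist x x₀ < 1 / 6 := by
    have := mul_lt_mul_of_pos_left hx hΛ0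
    rwa [mul_one_div, mul_comm (6 : ℝ), ← div_div, div_self hΛ0.ne'] at this
  have hs1 := abs_lt.1 (lt_of_le_of_lt (hslip x) hΛd)
  have ht1 := abs_lt.1 (lt_of_le_of_lt (htlip x) hΛd)
  have hs : 0 < sfun x := by linarith [hs1.1]
  have ht : 0 < tfun x := by linarith [ht1.1]
  have hr : 0 < 1 - sfun x - tfun x := by linarith [hs1.2, ht1.2]
  -- the convex combination
  have hne : 1 - tfun x ≠ 0 := by linarith
  have hmem : (1 - sfun x - tfun x) • A + sfun x • B + tfun x • C ∈ K := by
    have h1 : (1 - sfun x - tfun x) • A + sfun x • B + tfun x • C =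
        (1 - tfun x) • (((1 - sfun x - tfun x) / (1 - tfun x)) • A + (sfun x / (1 - tfun x)) • B) +
          tfun x • C := by
      rw [smul_add, smul_smul, smul_smul, mul_div_cancel₀ _ hne, mul_div_cancel₀ _ hne]
    rw [h1]
    refine hK (hK hA.1 hB.1 (div_nonneg hr.le (by linarith)) (div_nonneg hs.le (by linarith)) ?_)
      hC.1 (by linarith) ht.le (by ring)
    field_simp
    ring
  have heq : (1 - sfun x - tfun x) • A + sfun x • B + tfun x • C =
      (Fin.snoc x (κ 0 * x 0 + κ 1 * x 1 + c) : Fin (2 + 1) → ℝ) := by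
    have hb : ∀ i : Fin 2, ((1 - sfun x - tfun x) • A + sfun x • B + tfun x • C) (Fin.castSucc i) =
        x i := fun i => by
      have := hcomb x i
      simp only [ha, hu, hw] at this
      simp only [Pi.add_apply, Pi.smul_apply, smul_eq_mul]
      linarith
    funext l
    refine Fin.lastCases ?_ (fun i => ?_) l
    · rw [Fin.snoc_last]
      simp only [Pi.add_apply, Pi.smul_apply, smul_eq_mul]
      rw [hA.2, hB.2, hC.2, ← hb 0, ← hb 1]
      simp only [Pi.add_apply, Pi.smul_apply, smul_eq_mul]
      ring
    · rw [Fin.snoc_castSucc, hb]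
  rw [← heq]
  exact hmem

end SepThree

open SepThree in
/-- **The patch of a fat contact** (registered sub-goal of `stub_separateThreeZero`, part
`FatPatch`; see `SepThree.fat_patch`). -/
theorem separateThree_fat_patch (K : Set (Fin (2 + 1) → ℝ)) (hK : Convex ℝ K) (κ : Fin 2 → ℝ) (c : ℝ) (hfat : ¬ ∃ P u : Fin (2 + 1) → ℝ, ∀ z ∈ K, z (Fin.last 2) = κ 0 * z (Fin.castSucc 0) + κ 1 * z (Fin.castSucc 1) + c → ∃ t : ℝ, z = P + t • u) : ∃ x₀ : Fin 2 → ℝ, ∃ ρ > (0 : ℝ), ∀ x : Fin 2 → ℝ, dist x x₀ < ρ → (Fin.snoc x (κ 0 * x 0 + κ 1 * x 1 + c) : Fin (2 + 1) → ℝ) ∈ K :=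
  fat_patch hK κ c hfat

end Summit.KontsevichZagierPeriods.ArrangementNormalForm.JanusBands
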